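import Summits.QuantumFields.YangMills.Theorems.WeakCouplingRatesBulkDominatesColdBoxWDatumShiftIntegral

/-!
# Crux `BulkDominatesColdBoxW` (stmt-QuantumFields-19609), expansion stubs of skeleton v5/v6 (`stub_kernelMeanExpansion`, `stub_kernelCovExpansion`,
# `stub_flatCovExpansion`): brick R4c — the THREE-COLOUR mean-shift identity

The three-colour form of the lead's M3c (`lintegral_mul_wθ_dir_div_eq`, `Theorems/WeakCouplingRatesBulkDominatesColdBoxWDatumShiftIntegral.lean`):
after the chart and the rescaling `t = √(2β)·v` the Gaussian weight of the one-scale expansion is the product over the three colour components of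
the one-colour weights with data `ϑ_c`, `∏_c e^{−½M_{ϑ_c}(s_c)}` on `(Fin 3 → ℝ^{DirFree H})` with Lebesgue measure; normalised, it is the law of
`(μ_c + t_c)_c` with `t ∼ boxDirichlet H ^{⊗3}`, `μ_c = mean ϑ_c`:

  `(∫ g(s) ∏_c wθ_{ϑ_c}(s_c) ds) / (∫ ∏_c wθ_{ϑ_c}(s_c) ds) = ∫ g(t + μ) d(boxDirichlet H)^{⊗3}(t)`     (`lintegral_pi_mul_prod_wθ_dir_div_eq`).

Steps: the one-colour weighted Lebesgue measure IS a multiple of the translated D1' (`withDensity_wθ_dir_eq`, from M3c by `Measure.ext_of_lintegral`);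
products of multiples are multiples of products (`pi_smul_nnreal`); products of translates are translates of products (`Measure.pi_map_pi`); products of
densities are densities of products (the tree's `GaussianToolkit.pi_withDensity`).

Fleet seat `ym-spine-20043-p1` (g3; work split 22:20Z with the line lead `ym-wcr-19609-p1`; R4 was addressed to ★19608 seats, none live).  No sorry,
standard axioms, no new definition, no named-fact hypothesis.  NOT a claim about the mass gap.
-/

set_option autoImplicit false

noncomputable section

open MeasureTheory Finset Matrix WithLp
open scoped ENNReal NNReal
open Literature.Probability.LatticeModels
open Literature.MathematicalPhysics.QuantumLattice
open Literature.MathematicalPhysics.QuantumFieldTheory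
open Literature.MathematicalPhysics.QuantumFieldTheory.LatticeMaxwell
open Literature.MathematicalPhysics.QuantumFieldTheory.AxialGauge
open Literature.MathematicalPhysics.QuantumFieldTheory.GaussianToolkit

namespace Summit.QuantumFields.YangMills.Theorems.WeakCouplingRates

/-! ## §1 Products of multiples of measures -/

section PiSmul

variable {ι : Type*} [Fintype ι] {E : Type*} [MeasurableSpace E]

/-- `⊗ᵢ (rᵢ • μᵢ) = (∏ᵢ rᵢ) • ⊗ᵢ μᵢ` for `ℝ≥0` multiples of σ-finite measures. -/
theorem pi_smul_nnreal (μ : ι → Measure E) [∀ i, SigmaFinite (μ i)] (r : ι → ℝ≥0) :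
    Measure.pi (fun i => r i • μ i) = (∏ i, r i) • Measure.pi μ := by
  classical
  refine Measure.pi_eq fun s hs => ?_
  rw [Measure.smul_apply, Measure.pi_pi]
  simp only [Measure.smul_apply, ENNReal.smul_def, smul_eq_mul, ENNReal.ofNNReal_finsetProd, Finset.prod_mul_distrib]

end PiSmul

/-! ## §2 The one-colour weighted Lebesgue measure is a multiple of the translated Dirichlet Gaussian -/

section OneColour

variable {H : ℕ}

/-- The normalising constant `e^{−K_θ/2}·Z_D` of the datum-`θ` weight, as an `ℝ≥0` (it is finite and nonzero). -/
theorem wθ_dir_mass_ne (H : ℕ) (θ : Literature.MathematicalPhysics.QuantumLattice.ZdEdge 4 → ℝ) :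
    ENNReal.ofReal (Real.exp (-(Kconst (fun e => e ∉ dirFreeEdges H) dirCorner (2 * H + 3) θ) / 2)) *
        gaussZ (Qmat (fun e => e ∉ dirFreeEdges H) dirCorner (2 * H + 3)) ≠ 0 ∧
      ENNReal.ofReal (Real.exp (-(Kconst (fun e => e ∉ dirFreeEdges H) dirCorner (2 * H + 3) θ) / 2)) *
        gaussZ (Qmat (fun e => e ∉ dirFreeEdges H) dirCorner (2 * H + 3)) ≠ ∞ := by
  obtain ⟨-, hZ0, hZtop⟩ := boxDirichlet_eq_withDensity H
  exact ⟨mul_ne_zero (ENNReal.ofReal_ne_zero_iff.2 (Real.exp_pos _)) hZ0, ENNReal.mul_ne_top ENNReal.ofReal_ne_top hZtop⟩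

/-- **The datum-`θ` weighted Lebesgue measure is `(e^{−K_θ/2}Z_D) ×` the Dirichlet Gaussian translated by the mean `μ_θ`** (measure form of
`lintegral_mul_wθ_dir_eq`). -/
theorem withDensity_wθ_dir_eq (H : ℕ) (θ : Literature.MathematicalPhysics.QuantumLattice.ZdEdge 4 → ℝ) :
    (volume : Measure (EuclideanSpace ℝ (DirFree H))).withDensity (wθ (fun e => e ∉ dirFreeEdges H) dirCorner (2 * H + 3) θ) =
      (ENNReal.ofReal (Real.exp (-(Kconst (fun e => e ∉ dirFreeEdges H) dirCorner (2 * H + 3) θ) / 2)) *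
          gaussZ (Qmat (fun e => e ∉ dirFreeEdges H) dirCorner (2 * H + 3))).toNNReal •
        (boxDirichlet H).map (fun t => t + WithLp.toLp 2 (mean (fun e => e ∉ dirFreeEdges H) dirCorner (2 * H + 3) θ)) := by
  obtain ⟨h0, htop⟩ := wθ_dir_mass_ne H θ
  set r := ENNReal.ofReal (Real.exp (-(Kconst (fun e => e ∉ dirFreeEdges H) dirCorner (2 * H + 3) θ) / 2)) *
    gaussZ (Qmat (fun e => e ∉ dirFreeEdges H) dirCorner (2 * H + 3)) with hr
  set m : EuclideanSpace ℝ (DirFree H) := WithLp.toLp 2 (mean (fun e => e ∉ dirFreeEdges H) dirCorner (2 * H + 3) θ) with hm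
  refine Measure.ext_of_lintegral _ fun f hf => ?_
  rw [lintegral_withDensity_eq_lintegral_mul _ (measurable_wθ θ) hf, lintegral_smul_measure, lintegral_map hf (measurable_add_const m)]
  have h1 : ∫⁻ s, (wθ (fun e => e ∉ dirFreeEdges H) dirCorner (2 * H + 3) θ * f) s ∂(volume : Measure (EuclideanSpace ℝ (DirFree H))) =
      ∫⁻ s, f s * wθ (fun e => e ∉ dirFreeEdges H) dirCorner (2 * H + 3) θ s ∂(volume : Measure (EuclideanSpace ℝ (DirFree H))) :=
    lintegral_congr fun s => by simp only [Pi.mul_apply, mul_comm]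
  rw [h1, lintegral_mul_wθ_dir_eq H θ f hf, ← hr, ENNReal.smul_def, ENNReal.coe_toNNReal htop, smul_eq_mul]

/-- The datum-`θ` weighted Lebesgue measure is finite (hence σ-finite). -/
theorem isFiniteMeasure_withDensity_wθ_dir (H : ℕ) (θ : Literature.MathematicalPhysics.QuantumLattice.ZdEdge 4 → ℝ) :
    IsFiniteMeasure ((volume : Measure (EuclideanSpace ℝ (DirFree H))).withDensity (wθ (fun e => e ∉ dirFreeEdges H) dirCorner (2 * H + 3) θ)) := by
  refine isFiniteMeasure_withDensity ?_
  rw [lintegral_wθ_dir_eq]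
  exact (wθ_dir_mass_ne H θ).2

end OneColour

/-! ## §3 Three colours -/

section ThreeColours

variable {H : ℕ}

/-- **R4c — the three-colour mean-shift identity, measure form**: the product over the colours of the datum-`ϑ_c` weighted Lebesgue measures is
`(∏_c e^{−K_c/2}Z_D) ×` the image of `boxDirichlet H ^{⊗3}` under the translation `t ↦ (t_c + μ_c)_c`. -/
theorem pi_withDensity_wθ_dir_eq (ϑ : Fin 3 → (Literature.MathematicalPhysics.QuantumLattice.ZdEdge 4 → ℝ)) :
    (Measure.pi fun _ : Fin 3 => (volume : Measure (EuclideanSpace ℝ (DirFree H)))).withDensity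
        (fun s => ∏ c, wθ (fun e => e ∉ dirFreeEdges H) dirCorner (2 * H + 3) (ϑ c) (s c)) =
      (∏ c, (ENNReal.ofReal (Real.exp (-(Kconst (fun e => e ∉ dirFreeEdges H) dirCorner (2 * H + 3) (ϑ c)) / 2)) *
          gaussZ (Qmat (fun e => e ∉ dirFreeEdges H) dirCorner (2 * H + 3))).toNNReal) •
        (Measure.pi fun _ : Fin 3 => boxDirichlet H).map
          (fun t c => t c + WithLp.toLp 2 (mean (fun e => e ∉ dirFreeEdges H) dirCorner (2 * H + 3) (ϑ c))) := by
  haveI : ∀ c : Fin 3, SigmaFinite (((fun _ : Fin 3 => (volume : Measure (EuclideanSpace ℝ (DirFree H)))) c).withDensity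
      ((fun c => wθ (fun e => e ∉ dirFreeEdges H) dirCorner (2 * H + 3) (ϑ c)) c)) := fun c => by
    haveI := isFiniteMeasure_withDensity_wθ_dir H (ϑ c)
    simp only
    infer_instance
  have hpi := pi_withDensity (fun _ : Fin 3 => (volume : Measure (EuclideanSpace ℝ (DirFree H))))
    (fun c => wθ (fun e => e ∉ dirFreeEdges H) dirCorner (2 * H + 3) (ϑ c)) (fun c => measurable_wθ _)
  rw [← hpi]
  simp_rw [withDensity_wθ_dir_eq]
  rw [pi_smul_nnreal]
  congr 1
  rw [Measure.pi_map_pi (fun c => (measurable_add_const _).aemeasurable)]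

/-- **R4c — the three-colour mean-shift identity**: for measurable `g ≥ 0` and data `ϑ_c`,
`(∫ g(s)·∏_c e^{−½M_{ϑ_c}(s_c)} ds) / (∫ ∏_c e^{−½M_{ϑ_c}(s_c)} ds) = ∫ g((t_c + μ_c)_c) d(boxDirichlet H)^{⊗3}(t)`, `μ_c = mean ϑ_c`. -/
theorem lintegral_pi_mul_prod_wθ_dir_div_eq (ϑ : Fin 3 → (Literature.MathematicalPhysics.QuantumLattice.ZdEdge 4 → ℝ))
    (g : (Fin 3 → EuclideanSpace ℝ (DirFree H)) → ℝ≥0∞) (hg : Measurable g) :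
    (∫⁻ s, g s * ∏ c, wθ (fun e => e ∉ dirFreeEdges H) dirCorner (2 * H + 3) (ϑ c) (s c)
          ∂(Measure.pi fun _ : Fin 3 => (volume : Measure (EuclideanSpace ℝ (DirFree H))))) /
        ∫⁻ s, ∏ c, wθ (fun e => e ∉ dirFreeEdges H) dirCorner (2 * H + 3) (ϑ c) (s c)
          ∂(Measure.pi fun _ : Fin 3 => (volume : Measure (EuclideanSpace ℝ (DirFree H)))) =
      ∫⁻ t, g (fun c => t c + WithLp.toLp 2 (mean (fun e => e ∉ dirFreeEdges H) dirCorner (2 * H + 3) (ϑ c)))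
        ∂(Measure.pi fun _ : Fin 3 => boxDirichlet H) := by
  set w : (Fin 3 → EuclideanSpace ℝ (DirFree H)) → ℝ≥0∞ := fun s => ∏ c, wθ (fun e => e ∉ dirFreeEdges H) dirCorner (2 * H + 3) (ϑ c) (s c)
    with hw
  set R : ℝ≥0 := ∏ c, (ENNReal.ofReal (Real.exp (-(Kconst (fun e => e ∉ dirFreeEdges H) dirCorner (2 * H + 3) (ϑ c)) / 2)) *
    gaussZ (Qmat (fun e => e ∉ dirFreeEdges H) dirCorner (2 * H + 3))).toNNReal with hR
  set sh : (Fin 3 → EuclideanSpace ℝ (DirFree H)) → (Fin 3 → EuclideanSpace ℝ (DirFree H)) :=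
    fun t c => t c + WithLp.toLp 2 (mean (fun e => e ∉ dirFreeEdges H) dirCorner (2 * H + 3) (ϑ c)) with hsh
  have hwm : Measurable w := Finset.measurable_prod _ fun c _ => (measurable_wθ _).comp (measurable_pi_apply c)
  have hshm : Measurable sh := measurable_pi_lambda _ fun c => (measurable_pi_apply c).add_const _
  have hR0 : (R : ℝ≥0∞) ≠ 0 := by
    rw [hR, ENNReal.ofNNReal_finsetProd]
    refine Finset.prod_ne_zero_iff.2 fun c _ => ?_
    obtain ⟨h0, htop⟩ := wθ_dir_mass_ne H (ϑ c)
    rwa [ENNReal.coe_toNNReal htop]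
  -- every weighted integral is `R ×` the shifted Dirichlet integral
  have key : ∀ f : (Fin 3 → EuclideanSpace ℝ (DirFree H)) → ℝ≥0∞, Measurable f →
      ∫⁻ s, f s * w s ∂(Measure.pi fun _ : Fin 3 => (volume : Measure (EuclideanSpace ℝ (DirFree H)))) =
        R * ∫⁻ t, f (sh t) ∂(Measure.pi fun _ : Fin 3 => boxDirichlet H) := by
    intro f hf
    have h1 : ∫⁻ s, f s * w s ∂(Measure.pi fun _ : Fin 3 => (volume : Measure (EuclideanSpace ℝ (DirFree H)))) =
        ∫⁻ s, f s ∂((Measure.pi fun _ : Fin 3 => (volume : Measure (EuclideanSpace ℝ (DirFree H)))).withDensity w) := by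
      rw [lintegral_withDensity_eq_lintegral_mul _ hwm hf]
      exact lintegral_congr fun s => by simp only [Pi.mul_apply, mul_comm]
    rw [h1, hw, pi_withDensity_wθ_dir_eq ϑ, lintegral_smul_measure, lintegral_map hf hshm, ENNReal.smul_def, smul_eq_mul]
  have hnum := key g hg
  have hden := key (fun _ => 1) measurable_const
  simp only [one_mul, lintegral_const, measure_univ, mul_one] at hden
  rw [hnum, hden, mul_comm, ENNReal.mul_div_cancel_right hR0 ENNReal.coe_ne_top]

end ThreeColours

end Summit.QuantumFields.YangMills.Theorems.WeakCouplingRates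

end
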